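import Summits.QuantumFields.BalabanUV.T4Continuum.Support.StarCarrierNeumannHessian
import Summits.QuantumFields.BalabanUV.T4Continuum.Support.RegionLocalInjectedAssembly
import Summits.QuantumFields.BalabanUV.T4Continuum.Support.AlignedCarrierPairing

/-!
# T⁴ programme, spine node NE2 (U1a), sub-row Δ1 «NE2⁰-Dirichlet» — (P-gaffney)'s PER-COMPONENT SCALAR BUDGETS INSIDE THE OWNER's
# MASTER BUDGET `Ebud`: the spike rows, the transverse budgets, the Neumann pieces, summed over the components (file P5b-1 of (P-W))

NE2 formalisation swarm `b2b-balaban-t4-ne2-formalise-*`, LEAF PROVER 01 (gen 11), item «P5b» of the (P-W) socket for the rungs `1 ≤ k`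
(owner R43 / NOTE, journal `CLAIMS.log` 2026-08-21 l.23877 / l.23893; «MINE P5b» l.23942).  leaf-03-g8's per-component pairing (P5a
`StarCarrierComponentPairing.component_pairing_le`, staged) bounds ONE component `ν` of the first-order two-level identity
(`StarCarrierNeumannHessian.first_order_identity_lev_bmask`) by `cGaf R·(√N)⁻¹·√Bc(z_ν)·√Bf(z′_ν)` with the COARSE budget
`Bc z = Σ_{μ≠ν} budgetOn_T μ z + gradOn_T ν z + N²·spikeGrad z` and the FINE budget `Bf z′ = Σ_{μ≠ν} budgetOn_{T′} μ z′ + hessN z′ + (2·nsq z′ +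
gradOn_{T′} ν z′)`.  THIS FILE puts every summand of `Bc (zext ν u)` and `Bf (zext ν v)` inside the owner's master budget
`RegionLocalInjectedAssembly.Ebud n M a S w = nsq w + Re⟨w, Δ_loc(a) w⟩ + Σ_μ nsq (W_μ w) + nsq (Δ_loc(a) w)` (p239590), under H1 (`AtMostOneNeighbour`,
product regions at every level `≥ 2`) and `0 ≤ a`, and sums over the components:

 * §1 **THE SPIKE ROWS** `sq_spike_le` / **`spike_le`**: `N²·spikeGrad ν (zext ν u) ≤ nsq (W_ν u)` — at a spike pair `(y, y + e_ν)` of the star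
   carrier (`y ∉ Ω`, `y + e_ν ∈ Ω`; under H1 there are no others) the own-direction operator IS the spike difference:
   `(W_ν u)(y, ν) = −N·(∂_ν z_ν)(y)` (P4a `Wdir_mulVec_apply_self` / `Pneu_mulVec` with `χ_ν(y) = 1`, `χ_ν(y − e_ν) = 0`).
 * §2 the pieces: `budgetOn_zext_le` (`μ ≠ ν`; leaf-02-g8's `budget_transverse_le` in P2's `budgetOn` letters), `gradOn_zext_le` (leaf-02-g8's
   `budget_own_le` in P3b's `gradOn` letters); with P4c's `hessN_zext_le` / `nsq_zext_le`.
 * §3 **`coarse_component_le`**: `Σ_{μ≠ν} budgetOn_T μ z_ν + gradOn_T ν z_ν + N²·spikeGrad z_ν ≤ d·Ebud u`; **`fine_component_le`**: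
   `Σ_{μ≠ν} budgetOn_{T′} μ z′_ν + hessN z′_ν + (2·nsq z′_ν + gradOn_{T′} ν z′_ν) ≤ (d + 2)·Ebud v` — literally `Bc (zext ν u)` and `Bf (zext ν v)`
   unfolded; summed: **`sqrt_sum_coarse_le`** `√(Σ_ν …) ≤ d·√Ebud u`, **`sqrt_sum_fine_le`** `√(Σ_ν …) ≤ √(d(d+2))·√Ebud v`.
 * §4 `norm_sum_le_of_sqrt`: the Cauchy–Schwarz-over-components step `‖Σ_ν t_ν‖ ≤ c·√(Σ x_ν)·√(Σ y_ν)` from `‖t_ν‖ ≤ c·√x_ν·√y_ν`.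
 File P5b-2 (`Support/StarCarrierPairingAssembly`) composes these with P5a into the (P-W) bound `hPW1` for `1 ≤ k` with
 `ε k = cGaf L·d·√(d(d+2))·((√L)⁻¹)^k`.

HONEST FRAMING (T4-DAG p. 1).  [folklore] finite lattice bookkeeping (one pointwise identity at the spikes and sub-sum inequalities) at MODEL
level (`U = 1`, ONE region, finite torus); nothing printed is a hypothesis or a conclusion; no NE2 statement is proved here; (P-W) for `k ≥ 1` /
`hinjK` / W3 on boxes OPEN until P5a + P5b-2 land; NE2 (U1a) NOT proved; spine PROVED 0/9 unchanged; NOT [B9] (3.16)/(3.23)–(3.27) as printed; NOT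
infinite volume, NOT a mass gap, NOT the Clay problem.  HONEST DEPENDENCY: continuum YM on T⁴ ⇐ BetaPertH ∧ nine spine estimates (0/9 proved);
BetaPertH ⇐ (D1) ∧ (D4) ∧ CAP+tail; G-an2-4 gates asym, D1 and NE2/3/4.  No `sorry`.
-/

noncomputable section

open scoped BigOperators ComplexConjugate Matrix Matrix.Norms.L2Operator
open Finset

namespace Summit.QuantumFields.BalabanUV.T4Continuum.StarCarrierMasterBudget

open Literature.MathematicalPhysics.QuantumFieldTheory.Balaban1983to89.B5Prop11Plancherel (Tor fine unitVec)
open Literature.MathematicalPhysics.QuantumFieldTheory.Balaban1983to89.B5Prop11Lower (nsq nsq_nonneg)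
open Literature.MathematicalPhysics.QuantumFieldTheory.Balaban1983to89.B5Action121 (sdiff sdiff_mulVec)
open Summit.QuantumFields.BalabanUV.T4Continuum
open Summit.QuantumFields.BalabanUV.T4Continuum.SubtypeCompression (ext ext_apply_of nsq_ext)
open Summit.QuantumFields.BalabanUV.T4Continuum.RegionGaugeFixedVector (starReg)
open Summit.QuantumFields.BalabanUV.T4Continuum.RegionStarBoundaryCharges (AtMostOneNeighbour)
open Summit.QuantumFields.BalabanUV.T4Continuum.RegionElectricSplitting (Wdir not_star_add_iff)
open Summit.QuantumFields.BalabanUV.T4Continuum.RegionGaugeResolventSplit (regionDeltaLoc)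
open Summit.QuantumFields.BalabanUV.T4Continuum.RegionLocalInjectedAssembly (Ebud Ebud_nonneg form_regionDeltaLoc_nonneg)
open Summit.QuantumFields.BalabanUV.T4Continuum.AlignedCarrierTrace (starSite starSite_iff)
open Summit.QuantumFields.BalabanUV.T4Continuum.AlignedCarrierPairing (budgetOn budgetOn_nonneg)
open Summit.QuantumFields.BalabanUV.T4Continuum.CarrierColumnTrace (gradOn gradOn_nonneg)
open Summit.QuantumFields.BalabanUV.T4Continuum.StarCarrierComponents (zext chi Pneu_mulVec Wdir_mulVec_apply_self)
open Summit.QuantumFields.BalabanUV.T4Continuum.StarCarrierNeumannPairing (hessN spikeGrad bsp bm)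
open Summit.QuantumFields.BalabanUV.T4Continuum.StarCarrierNeumannHessian (hessN_zext_le nsq_zext_le)
open Summit.QuantumFields.BalabanUV.T4Continuum.RegionElectricDictionary (budget_transverse_le budget_own_le)
open Summit.QuantumFields.BalabanUV.Beta.GAN24.DirichletBoxTrace (blockReg)

variable {d : ℕ}

/-! ## §1 The spike rows: `N²·spikeGrad ν (zext ν u) ≤ ‖W_ν u‖²` -/

section Spikes

variable (n : ℕ) [NeZero n] (M : Fin d → ℕ) [hM : ∀ μ, NeZero (M μ)] (S : Tor M → Prop) [DecidablePred S]

/-- **AT A SPIKE PAIR THE OWN-DIRECTION OPERATOR IS THE SPIKE DIFFERENCE** (H1), pointwise and squared: for the electric mask's non-interior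
faces `(y, y + e_ν)` (`y ∉ Ω`, `y + e_ν ∈ Ω`), `N²·‖(∂_ν z_ν)(y)‖² = ‖(W_ν u)(y, ν)‖²`; everywhere else the left side is `0`. [folklore] -/
theorem sq_spike_le (hH : AtMostOneNeighbour n M S) (ν : Fin d) (u : {b // starReg n M S b} → ℂ) (y : Tor (fine n M)) :
    (n : ℝ) ^ 2 * ‖bsp n M S ν (fun y => starSite n M S ν y ∧ starSite n M S ν (y + unitVec (fine n M) ν)) (zext n M S ν u) y‖ ^ 2
      ≤ ‖ext (starReg n M S) (Wdir n M S ν *ᵥ u) (y, ν)‖ ^ 2 := by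
  unfold bsp bm
  split_ifs with hI hm
  · rw [norm_zero, zero_pow two_ne_zero, mul_zero]; positivity
  · -- under H1 the tail `y` is outside `Ω` and the head `y + e_ν` inside
    have hy : ¬ blockReg n M S y := by
      intro hy
      have hye : ¬ blockReg n M S (y + unitVec (fine n M) ν) := fun h => hI ⟨hy, h⟩
      exact (not_star_add_iff n M S hH ⟨(y, ν), hm.1⟩).mpr hye hm.2
    have hye : blockReg n M S (y + unitVec (fine n M) ν) := ((starSite_iff n M S ν y).mp hm.1).resolve_left hy
    rw [ext_apply_of (starReg n M S) _ ⟨(y, ν), hm.1⟩, Wdir_mulVec_apply_self n M S hH ν u hm.1, Pneu_mulVec, sdiff_mulVec]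
    have c1 : chi n M S ν y = 1 := by unfold chi; rw [if_pos hye]
    have c2 : chi n M S ν (y - unitVec (fine n M) ν) = 0 := by unfold chi; rw [sub_add_cancel, if_neg hy]
    simp only [c1, c2, zero_mul, zero_sub, one_mul, norm_neg, norm_mul, Complex.norm_natCast]
    exact le_of_eq (by ring)
  · rw [norm_zero, zero_pow two_ne_zero, mul_zero]; positivity

/-- **THE SPIKE ROWS ARE INSIDE THE DIRECTIONAL HESSIAN** (H1): `N²·spikeGrad ν (zext ν u) ≤ nsq (W_ν u)` — the `N²·spikeGrad` summand of P5a's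
coarse budget `Bc` is a sub-sum of the owner's `Σ_μ nsq (Wdir μ u) ⊂ Ebud`. [folklore] -/
theorem spike_le (hH : AtMostOneNeighbour n M S) (ν : Fin d) (u : {b // starReg n M S b} → ℂ) :
    (n : ℝ) ^ 2 * spikeGrad n M S ν (zext n M S ν u) ≤ nsq (Wdir n M S ν *ᵥ u) := by
  have h1 : (n : ℝ) ^ 2 * spikeGrad n M S ν (zext n M S ν u)
      = ∑ y, (n : ℝ) ^ 2 * ‖bsp n M S ν (fun y => starSite n M S ν y ∧ starSite n M S ν (y + unitVec (fine n M) ν)) (zext n M S ν u) y‖ ^ 2 := by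
    rw [spikeGrad, nsq, Finset.mul_sum]
  rw [h1, ← nsq_ext (starReg n M S) (Wdir n M S ν *ᵥ u), nsq, Fintype.sum_prod_type]
  calc ∑ y, (n : ℝ) ^ 2 * ‖bsp n M S ν (fun y => starSite n M S ν y ∧ starSite n M S ν (y + unitVec (fine n M) ν)) (zext n M S ν u) y‖ ^ 2
      ≤ ∑ y, ‖ext (starReg n M S) (Wdir n M S ν *ᵥ u) (y, ν)‖ ^ 2 := Finset.sum_le_sum fun y _ => sq_spike_le n M S hH ν u y
    _ ≤ ∑ y, ∑ ν', ‖ext (starReg n M S) (Wdir n M S ν *ᵥ u) (y, ν')‖ ^ 2 :=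
        Finset.sum_le_sum fun y _ =>
          Finset.single_le_sum (f := fun ν' => ‖ext (starReg n M S) (Wdir n M S ν *ᵥ u) (y, ν')‖ ^ 2) (fun _ _ => sq_nonneg _)
            (Finset.mem_univ ν)

end Spikes

/-! ## §2 The per-component scalar budgets against the local form and the directional Hessian -/

section Pieces

variable (n : ℕ) [NeZero n] (M : Fin d → ℕ) [hM : ∀ μ, NeZero (M μ)] (S : Tor M → Prop) [DecidablePred S] {a : ℝ}

/-- the transverse budget of a component (P2's `budgetOn` letters; `μ ≠ ν`, H1, `0 ≤ a`):
`budgetOn_T μ (zext ν v) ≤ Re⟨v, Δ_loc(a) v⟩ + nsq (W_μ v)` (leaf-02-g8's `budget_transverse_le`). [folklore] -/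
theorem budgetOn_zext_le (hH : AtMostOneNeighbour n M S) (ha : 0 ≤ a) {μ ν : Fin d} (hμν : μ ≠ ν) (v : {b // starReg n M S b} → ℂ) :
    budgetOn n M (starSite n M S ν) μ (zext n M S ν v)
      ≤ (star v ⬝ᵥ (regionDeltaLoc n M a S *ᵥ v)).re + nsq (Wdir n M S μ *ᵥ v) := by
  unfold budgetOn
  exact budget_transverse_le n M S hH ha hμν v

/-- the own-direction masked gradient of a component (P3b's `gradOn` letters; H1, `0 ≤ a`):
`gradOn_T ν (zext ν v) ≤ Re⟨v, Δ_loc(a) v⟩` (leaf-02-g8's `budget_own_le`). [folklore] -/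
theorem gradOn_zext_le (hH : AtMostOneNeighbour n M S) (ha : 0 ≤ a) (ν : Fin d) (v : {b // starReg n M S b} → ℂ) :
    gradOn n M (starSite n M S ν) ν (zext n M S ν v) ≤ (star v ⬝ᵥ (regionDeltaLoc n M a S *ᵥ v)).re := by
  unfold gradOn
  rw [Finset.sum_filter]
  exact budget_own_le n M S hH ha ν v

/-- the transverse budgets summed over `μ ≠ ν`: `Σ_{μ≠ν} budgetOn_T μ (zext ν v) ≤ Σ_{μ≠ν} (Re⟨v, Δ_loc v⟩ + nsq (W_μ v))`. [folklore] -/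
theorem sum_budgetOn_zext_le (hH : AtMostOneNeighbour n M S) (ha : 0 ≤ a) (ν : Fin d) (v : {b // starReg n M S b} → ℂ) :
    ∑ μ ∈ univ.erase ν, budgetOn n M (starSite n M S ν) μ (zext n M S ν v)
      ≤ ∑ μ ∈ univ.erase ν, ((star v ⬝ᵥ (regionDeltaLoc n M a S *ᵥ v)).re + nsq (Wdir n M S μ *ᵥ v)) :=
  Finset.sum_le_sum fun _ hμ => budgetOn_zext_le n M S hH ha (Finset.ne_of_mem_erase hμ) v

/-- bookkeeping: `Σ_{μ≠ν} (F + w μ) + (F + w ν) = d·F + Σ_μ w μ`. [folklore] -/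
theorem sum_erase_add_eq (F : ℝ) (w : Fin d → ℝ) (ν : Fin d) :
    ∑ μ ∈ univ.erase ν, (F + w μ) + (F + w ν) = (d : ℝ) * F + ∑ μ, w μ := by
  rw [Finset.sum_erase_add _ _ (Finset.mem_univ ν), Finset.sum_add_distrib, Finset.sum_const, Finset.card_univ, Fintype.card_fin,
    nsmul_eq_mul]

/-- `1 ≤ d` as soon as a component `ν : Fin d` exists. [folklore] -/
theorem one_le_dim (ν : Fin d) : (1 : ℝ) ≤ d := by
  exact_mod_cast Nat.succ_le_of_lt (lt_of_le_of_lt (Nat.zero_le _) ν.isLt)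

/-- `d·Re⟨w, Δ_loc w⟩ + Σ_μ nsq (W_μ w) + 2·nsq w ≤ (d + 2)·Ebud w` (`0 ≤ a`). [folklore] -/
theorem form_hess_mass_le (ha : 0 ≤ a) (ν : Fin d) (w : {b // starReg n M S b} → ℂ) :
    (d : ℝ) * (star w ⬝ᵥ (regionDeltaLoc n M a S *ᵥ w)).re + ∑ μ, nsq (Wdir n M S μ *ᵥ w) + 2 * nsq w
      ≤ ((d : ℝ) + 2) * Ebud n M a S w := by
  have hF0 := form_regionDeltaLoc_nonneg n M a S ha w
  have hW0 : 0 ≤ ∑ μ, nsq (Wdir n M S μ *ᵥ w) := Finset.sum_nonneg fun μ _ => nsq_nonneg _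
  have hu0 := nsq_nonneg w
  have hD0 := nsq_nonneg (regionDeltaLoc n M a S *ᵥ w)
  have hd := one_le_dim ν
  have hE : Ebud n M a S w = nsq w + (star w ⬝ᵥ (regionDeltaLoc n M a S *ᵥ w)).re + ∑ μ, nsq (Wdir n M S μ *ᵥ w)
      + nsq (regionDeltaLoc n M a S *ᵥ w) := rfl
  rw [hE]
  nlinarith [mul_nonneg (by linarith : (0 : ℝ) ≤ d) hu0, mul_nonneg (by linarith : (0 : ℝ) ≤ d) hD0,
    mul_nonneg (by linarith : (0 : ℝ) ≤ d) hW0]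

/-- `d·Re⟨w, Δ_loc w⟩ + Σ_μ nsq (W_μ w) ≤ d·Ebud w` (`0 ≤ a`, `1 ≤ d`). [folklore] -/
theorem form_hess_le (ha : 0 ≤ a) (ν : Fin d) (w : {b // starReg n M S b} → ℂ) :
    (d : ℝ) * (star w ⬝ᵥ (regionDeltaLoc n M a S *ᵥ w)).re + ∑ μ, nsq (Wdir n M S μ *ᵥ w) ≤ (d : ℝ) * Ebud n M a S w := by
  have hF0 := form_regionDeltaLoc_nonneg n M a S ha w
  have hW0 : 0 ≤ ∑ μ, nsq (Wdir n M S μ *ᵥ w) := Finset.sum_nonneg fun μ _ => nsq_nonneg _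
  have hu0 := nsq_nonneg w
  have hD0 := nsq_nonneg (regionDeltaLoc n M a S *ᵥ w)
  have hd := one_le_dim ν
  have hE : Ebud n M a S w = nsq w + (star w ⬝ᵥ (regionDeltaLoc n M a S *ᵥ w)).re + ∑ μ, nsq (Wdir n M S μ *ᵥ w)
      + nsq (regionDeltaLoc n M a S *ᵥ w) := rfl
  rw [hE]
  nlinarith [mul_nonneg (by linarith : (0 : ℝ) ≤ d) hu0, mul_nonneg (by linarith : (0 : ℝ) ≤ d) hD0,
    mul_nonneg (by linarith : (0 : ℝ) ≤ (d : ℝ) - 1) hW0]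

end Pieces

/-! ## §3 The coarse and the fine budget of one component inside `Ebud`, and their sums over the components -/

section Coarse

variable (n : ℕ) [NeZero n] (M : Fin d → ℕ) [hM : ∀ μ, NeZero (M μ)] (S : Tor M → Prop) [DecidablePred S] {a : ℝ}

/-- **THE COARSE BUDGET OF A COMPONENT** (P5a's `Bc (zext ν u)` unfolded; H1, `0 ≤ a`):
`Σ_{μ≠ν} budgetOn_T μ z_ν + gradOn_T ν z_ν + N²·spikeGrad z_ν ≤ d·Ebud u`. [folklore] -/
theorem coarse_component_le (hH : AtMostOneNeighbour n M S) (ha : 0 ≤ a) (ν : Fin d) (u : {b // starReg n M S b} → ℂ) :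
    (∑ μ ∈ univ.erase ν, budgetOn n M (starSite n M S ν) μ (zext n M S ν u))
        + gradOn n M (starSite n M S ν) ν (zext n M S ν u) + (n : ℝ) ^ 2 * spikeGrad n M S ν (zext n M S ν u)
      ≤ (d : ℝ) * Ebud n M a S u := by
  have h1 := sum_budgetOn_zext_le n M S hH ha ν u
  have h2 := gradOn_zext_le n M S hH ha ν u
  have h3 := spike_le n M S hH ν u
  have h4 := sum_erase_add_eq ((star u ⬝ᵥ (regionDeltaLoc n M a S *ᵥ u)).re) (fun μ => nsq (Wdir n M S μ *ᵥ u)) ν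
  have h5 := form_hess_le n M S ha ν u
  linarith

/-- summed over the components: `Σ_ν (coarse budget of z_ν) ≤ d²·Ebud u`. [folklore] -/
theorem sum_coarse_le (hH : AtMostOneNeighbour n M S) (ha : 0 ≤ a) (u : {b // starReg n M S b} → ℂ) :
    ∑ ν, ((∑ μ ∈ univ.erase ν, budgetOn n M (starSite n M S ν) μ (zext n M S ν u))
        + gradOn n M (starSite n M S ν) ν (zext n M S ν u) + (n : ℝ) ^ 2 * spikeGrad n M S ν (zext n M S ν u))
      ≤ (d : ℝ) ^ 2 * Ebud n M a S u := by
  calc _ ≤ ∑ _ν : Fin d, (d : ℝ) * Ebud n M a S u := Finset.sum_le_sum fun ν _ => coarse_component_le n M S hH ha ν u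
    _ = (d : ℝ) ^ 2 * Ebud n M a S u := by
        rw [Finset.sum_const, Finset.card_univ, Fintype.card_fin, nsmul_eq_mul]; ring

/-- the coarse budgets are nonnegative. [folklore] -/
theorem coarse_nonneg (ν : Fin d) (z : Tor (fine n M) → ℂ) :
    0 ≤ (∑ μ ∈ univ.erase ν, budgetOn n M (starSite n M S ν) μ z) + gradOn n M (starSite n M S ν) ν z + (n : ℝ) ^ 2 * spikeGrad n M S ν z := by
  have h1 : 0 ≤ ∑ μ ∈ univ.erase ν, budgetOn n M (starSite n M S ν) μ z := Finset.sum_nonneg fun μ _ => budgetOn_nonneg _ _ _ _ _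
  have h2 := gradOn_nonneg n M (starSite n M S ν) ν z
  have h3 : 0 ≤ spikeGrad n M S ν z := nsq_nonneg _
  positivity

/-- **`√(Σ_ν coarse budget of z_ν) ≤ d·√Ebud u`**. [folklore] -/
theorem sqrt_sum_coarse_le (hH : AtMostOneNeighbour n M S) (ha : 0 ≤ a) (u : {b // starReg n M S b} → ℂ) :
    Real.sqrt (∑ ν, ((∑ μ ∈ univ.erase ν, budgetOn n M (starSite n M S ν) μ (zext n M S ν u))
        + gradOn n M (starSite n M S ν) ν (zext n M S ν u) + (n : ℝ) ^ 2 * spikeGrad n M S ν (zext n M S ν u)))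
      ≤ (d : ℝ) * Real.sqrt (Ebud n M a S u) := by
  calc _ ≤ Real.sqrt ((d : ℝ) ^ 2 * Ebud n M a S u) := Real.sqrt_le_sqrt (sum_coarse_le n M S hH ha u)
    _ = (d : ℝ) * Real.sqrt (Ebud n M a S u) := by rw [Real.sqrt_mul (sq_nonneg _), Real.sqrt_sq (Nat.cast_nonneg d)]

end Coarse

section Fine

variable (N R : ℕ) [NeZero N] [NeZero R] (M : Fin d → ℕ) [hM : ∀ μ, NeZero (M μ)] (S : Tor M → Prop) [DecidablePred S] {a : ℝ}

/-- **THE FINE BUDGET OF A COMPONENT** (P5a's `Bf (zext ν v)` unfolded; H1 at the fine level `R·N`, `0 ≤ a`):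
`Σ_{μ≠ν} budgetOn_{T′} μ z′_ν + hessN z′_ν + (2·nsq z′_ν + gradOn_{T′} ν z′_ν) ≤ (d + 2)·Ebud v` (P4c's `hessN_zext_le`, `nsq_zext_le`). [folklore] -/
theorem fine_component_le (hH : AtMostOneNeighbour (R * N) M S) (ha : 0 ≤ a) (ν : Fin d) (v : {b // starReg (R * N) M S b} → ℂ) :
    (∑ μ ∈ univ.erase ν, budgetOn (R * N) M (starSite (R * N) M S ν) μ (zext (R * N) M S ν v))
        + hessN N R M S ν (zext (R * N) M S ν v)
        + (2 * nsq (zext (R * N) M S ν v) + gradOn (R * N) M (starSite (R * N) M S ν) ν (zext (R * N) M S ν v))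
      ≤ ((d : ℝ) + 2) * Ebud (R * N) M a S v := by
  have h1 := sum_budgetOn_zext_le (R * N) M S hH ha ν v
  have h2 := gradOn_zext_le (R * N) M S hH ha ν v
  have h3 := hessN_zext_le N R M S hH ν v
  have h3' := nsq_zext_le M S (R * N) ν v
  have h4 := sum_erase_add_eq ((star v ⬝ᵥ (regionDeltaLoc (R * N) M a S *ᵥ v)).re) (fun μ => nsq (Wdir (R * N) M S μ *ᵥ v)) ν
  have h5 := form_hess_mass_le (R * N) M S ha ν v
  linarith

/-- summed over the components: `Σ_ν (fine budget of z′_ν) ≤ d(d + 2)·Ebud v`. [folklore] -/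
theorem sum_fine_le (hH : AtMostOneNeighbour (R * N) M S) (ha : 0 ≤ a) (v : {b // starReg (R * N) M S b} → ℂ) :
    ∑ ν, ((∑ μ ∈ univ.erase ν, budgetOn (R * N) M (starSite (R * N) M S ν) μ (zext (R * N) M S ν v))
        + hessN N R M S ν (zext (R * N) M S ν v)
        + (2 * nsq (zext (R * N) M S ν v) + gradOn (R * N) M (starSite (R * N) M S ν) ν (zext (R * N) M S ν v)))
      ≤ (d : ℝ) * ((d : ℝ) + 2) * Ebud (R * N) M a S v := by
  calc _ ≤ ∑ _ν : Fin d, ((d : ℝ) + 2) * Ebud (R * N) M a S v := Finset.sum_le_sum fun ν _ => fine_component_le N R M S hH ha ν v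
    _ = (d : ℝ) * ((d : ℝ) + 2) * Ebud (R * N) M a S v := by
        rw [Finset.sum_const, Finset.card_univ, Fintype.card_fin, nsmul_eq_mul]; ring

/-- the fine budgets are nonnegative. [folklore] -/
theorem fine_nonneg (ν : Fin d) (z' : Tor (fine (R * N) M) → ℂ) :
    0 ≤ (∑ μ ∈ univ.erase ν, budgetOn (R * N) M (starSite (R * N) M S ν) μ z') + hessN N R M S ν z'
        + (2 * nsq z' + gradOn (R * N) M (starSite (R * N) M S ν) ν z') := by
  have h1 : 0 ≤ ∑ μ ∈ univ.erase ν, budgetOn (R * N) M (starSite (R * N) M S ν) μ z' :=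
    Finset.sum_nonneg fun μ _ => budgetOn_nonneg _ _ _ _ _
  have h2 : 0 ≤ hessN N R M S ν z' := Finset.sum_nonneg fun _ _ => sq_nonneg _
  have h3 := gradOn_nonneg (R * N) M (starSite (R * N) M S ν) ν z'
  have h4 := nsq_nonneg z'
  positivity

/-- **`√(Σ_ν fine budget of z′_ν) ≤ √(d(d + 2))·√Ebud v`**. [folklore] -/
theorem sqrt_sum_fine_le (hH : AtMostOneNeighbour (R * N) M S) (ha : 0 ≤ a) (v : {b // starReg (R * N) M S b} → ℂ) :
    Real.sqrt (∑ ν, ((∑ μ ∈ univ.erase ν, budgetOn (R * N) M (starSite (R * N) M S ν) μ (zext (R * N) M S ν v))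
        + hessN N R M S ν (zext (R * N) M S ν v)
        + (2 * nsq (zext (R * N) M S ν v) + gradOn (R * N) M (starSite (R * N) M S ν) ν (zext (R * N) M S ν v))))
      ≤ Real.sqrt ((d : ℝ) * ((d : ℝ) + 2)) * Real.sqrt (Ebud (R * N) M a S v) := by
  calc _ ≤ Real.sqrt ((d : ℝ) * ((d : ℝ) + 2) * Ebud (R * N) M a S v) := Real.sqrt_le_sqrt (sum_fine_le N R M S hH ha v)
    _ = Real.sqrt ((d : ℝ) * ((d : ℝ) + 2)) * Real.sqrt (Ebud (R * N) M a S v) := Real.sqrt_mul (by positivity) _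

end Fine

/-! ## §4 Cauchy–Schwarz over the components -/

/-- **`‖Σ_ν t_ν‖ ≤ c·√(Σ_ν x_ν)·√(Σ_ν y_ν)`** from `‖t_ν‖ ≤ c·√x_ν·√y_ν` (`0 ≤ c`, `0 ≤ x_ν, y_ν`). [folklore] -/
theorem norm_sum_le_of_sqrt {ι : Type*} (s : Finset ι) {t : ι → ℂ} {x y : ι → ℝ} {c : ℝ} (hc : 0 ≤ c)
    (hx : ∀ i, 0 ≤ x i) (hy : ∀ i, 0 ≤ y i) (h : ∀ i ∈ s, ‖t i‖ ≤ c * (Real.sqrt (x i) * Real.sqrt (y i))) :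
    ‖∑ i ∈ s, t i‖ ≤ c * (Real.sqrt (∑ i ∈ s, x i) * Real.sqrt (∑ i ∈ s, y i)) :=
  calc ‖∑ i ∈ s, t i‖ ≤ ∑ i ∈ s, ‖t i‖ := norm_sum_le _ _
    _ ≤ ∑ i ∈ s, c * (Real.sqrt (x i) * Real.sqrt (y i)) := Finset.sum_le_sum h
    _ = c * ∑ i ∈ s, Real.sqrt (x i) * Real.sqrt (y i) := by rw [Finset.mul_sum]
    _ ≤ c * (Real.sqrt (∑ i ∈ s, x i) * Real.sqrt (∑ i ∈ s, y i)) :=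
        mul_le_mul_of_nonneg_left (Real.sum_sqrt_mul_sqrt_le s hx hy) hc

end Summit.QuantumFields.BalabanUV.T4Continuum.StarCarrierMasterBudget

end
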